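import Literature.AnabelianGeometry.AbsoluteAnabelian.AbsTopIII.BiAnabelianCompatibilityGlue

/-!
# [AbsTopIII] Cor. 3.7 (v), final sentence — the shift is compatible with the glue family `K₁`

[cite: MochizukiAbsTopIII2015, Cor 3.7 (v) p.88]

abc-iut-L4-t5 (gen 5), row «COR37-COMPAT-LITERAL», sequel of `BiAnabelianCompatibilityGlue.lean` (p446969): the
nexus self-equivalences `Φ_m` (abc-iut-L4-t12's `shiftEquiv m`) are compatible, in the sense of Def. 3.5 (v)
(`OneMorphism.CompatibleWith`), with the glue family `K₁` that realises the `𝔈`-cores of (i), (ii) AND the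
`𝒳`-core of (i) — the cores part of "compatible with the families of homotopies that constitute the cores and
observables of (i), (ii), (iii)" of Cor. 3.7 (v), now INCLUDING the `𝒳`-core, for EVERY setting and every `m`
(abc-iut-w6-d023's quiver-generic `DiagramShiftInvariance*` pattern, as in `compatibleWith_shiftEquiv_coresFamily`).
Proof-only; model-level; nothing here bears on [IUTchIII] Cor. 3.12.
-/

set_option autoImplicit false

namespace Literature.AnabelianGeometry.AbsoluteAnabelian.AbsTopIII

open CategoryTheory Quiver
open Literature.AnabelianGeometry.AbsoluteAnabelian.DiagramOfCategories

universe u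

namespace BiAnabelianSetting

variable {X E N : Type u} [Category.{u} X] [Category.{u} E] [Category.{u} N]
  (𝔖 : BiAnabelianSetting X E N)

/-- The core vertices `𝔈`, `𝒳` are fixed by the shift. [cite: MochizukiAbsTopIII2015, Cor 3.7 (v) p.88] -/
theorem coreVertices₂_shift (m : ℤ) :
    ∀ w : Cor37Vertex, coreVertices₂ w → coreVertices₂ (Cor37Vertex.shiftObj m w) := by
  rintro w (rfl | rfl)
  · exact Or.inl rfl
  · exact Or.inr rfl

/-- The shift moves no vertex onto `𝔈` except `𝔈`. [cite: MochizukiAbsTopIII2015, Cor 3.7 (v) p.88] -/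
theorem shiftObj_eq_galois_iff (m : ℤ) (b : Cor37Vertex) :
    Cor37Vertex.shiftObj m b = .galois ↔ b = .galois := by
  cases b <;> simp [Cor37Vertex.shiftObj]

/-- The boundary set of `K₁` is stable under the shift. [cite: MochizukiAbsTopIII2015, Cor 3.7 (v) p.88] -/
theorem glueFamily_E_shift (m : ℤ) {a b : Cor37Vertex} {P Q : Path a b} (h : 𝔖.glueFamily.E P Q) :
    𝔖.glueFamily.E ((Cor37Vertex.shift.{u, u} m).mapPath P) ((Cor37Vertex.shift.{u, u} m).mapPath Q) :=
  univE_mapPath coreVertices₂ (Cor37Vertex.shift.{u, u} m) (coreVertices₂_shift m) h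

/-- `Φ_Γ⃗` induces a bijection between the boundary sets of `K₁`. [cite: MochizukiAbsTopIII2015, Cor 3.7 (v) p.88] -/
theorem glueFamily_E_shift_iff (m : ℤ) {a b : Cor37Vertex} (P Q : Path a b) :
    𝔖.glueFamily.E P Q ↔
      𝔖.glueFamily.E ((Cor37Vertex.shift.{u, u} m).mapPath P) ((Cor37Vertex.shift.{u, u} m).mapPath Q) :=
  HomotopyFamily.E_mapPath_iff_of_inverse (Cor37Vertex.shift_comp_neg m) 𝔖.glueFamily.E
    (fun _ _ _ _ h => 𝔖.glueFamily_E_shift m h) (fun _ _ _ _ h => 𝔖.glueFamily_E_shift (-m) h) P Q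

/-- `eqToHom`s between heterogeneously equal functors are heterogeneously equal (the categories of objects
varying along propositional equalities). [folklore] -/
private theorem eqToHom_heq_eqToHom' {A A' B B' : Type u} [iA : Category.{u} A] [iA' : Category.{u} A']
    [iB : Category.{u} B] [iB' : Category.{u} B'] (hA : A = A') (hiA : HEq iA iA') (hB : B = B')
    (hiB : HEq iB iB') {P Q : A ⥤ B} {P' Q' : A' ⥤ B'} (hP : HEq P P') (hQ : HEq Q Q') (e : P = Q)
    (e' : P' = Q') : HEq (eqToHom e) (eqToHom e') := by
  subst hA; subst hB; cases hiA; cases hiB; cases hP; cases hQ; rfl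

/-- The homotopies of `K₁` are invariant under the shift: `K₀`'s are (`coresFamily_η_shift_heq`), and the
identity ones trivially. [cite: MochizukiAbsTopIII2015, Cor 3.7 (v) p.88] -/
theorem glueFamily_η_shift_heq (m : ℤ) {a b : Cor37Vertex} {P Q : Path a b} (h : 𝔖.glueFamily.E P Q)
    (h' : 𝔖.glueFamily.E ((Cor37Vertex.shift.{u, u} m).mapPath P) ((Cor37Vertex.shift.{u, u} m).mapPath Q)) :
    HEq (𝔖.glueFamily.η h') (𝔖.glueFamily.η h) := by
  by_cases hb : b = .galois
  · have hK : 𝔖.coresFamily.E P Q := (𝔖.coresFamily_E_iff P Q).2 hb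
    have hK' := 𝔖.coresFamily_E_shift m hK
    change HEq (𝔖.glueη h') (𝔖.glueη h)
    rw [𝔖.glueη_of_E h hK, 𝔖.glueη_of_E h' hK']
    exact 𝔖.coresFamily_η_shift_heq m hK hK'
  · have hb' : (Cor37Vertex.shift.{u, u} m).obj b ≠ .galois := fun e => hb ((shiftObj_eq_galois_iff m b).1 e)
    change HEq (𝔖.glueη h') (𝔖.glueη h)
    rw [𝔖.glueη_of_not h hb, 𝔖.glueη_of_not h' hb']
    exact eqToHom_heq_eqToHom'
      (𝔖.starDiagram.obj_eq_of_comapAlong_eq _ (𝔖.comapAlong_shift m) a)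
      (𝔖.starDiagram.cat_heq_of_comapAlong_eq _ (𝔖.comapAlong_shift m) a)
      (𝔖.starDiagram.obj_eq_of_comapAlong_eq _ (𝔖.comapAlong_shift m) b)
      (𝔖.starDiagram.cat_heq_of_comapAlong_eq _ (𝔖.comapAlong_shift m) b)
      (𝔖.starDiagram.pathFunctor_mapPath_heq _ (𝔖.comapAlong_shift m) P)
      (𝔖.starDiagram.pathFunctor_mapPath_heq _ (𝔖.comapAlong_shift m) Q) _ _

/-- **[AbsTopIII] Cor. 3.7 (v), final sentence, CORES-AND-`𝒳`-CORE PART — PROVED for every setting**: the nexus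
self-equivalence `Φ_m` is compatible (Def. 3.5 (v)) with the glue family `K₁` realising the `𝔈`-cores of (i), (ii)
and the `𝒳`-core of (i) (`exists_realises_cores_and_refCore`). [cite: MochizukiAbsTopIII2015, Cor 3.7 (v) p.88] -/
theorem compatibleWith_shiftEquiv_glueFamily (m : ℤ) :
    Nonempty ((𝔖.shiftEquiv m).hom.CompatibleWith 𝔖.glueFamily 𝔖.glueFamily) :=
  OneMorphism.nonempty_compatibleWith_of_invariant (𝔖.shiftMor m) (𝔖.comapAlong_shift m)
    (𝔖.shiftApp_heq_id m) (𝔖.shiftMor_iso_app m)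
    (fun _ _ p' => Prefunctor.exists_mapPath_eq_of_inverse (Cor37Vertex.shift_comp_neg m)
      (Cor37Vertex.shift_neg_comp m) p')
    𝔖.glueFamily 𝔖.glueFamily (fun _ _ P Q => 𝔖.glueFamily_E_shift_iff m P Q)
    (fun _ _ _ _ h => 𝔖.glueFamily_η_shift_heq m h _)

end BiAnabelianSetting

end Literature.AnabelianGeometry.AbsoluteAnabelian.AbsTopIII
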